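import Summits.AtomisticToContinuum.BoseEinsteinCondensation.Theorems.BECThomsonPrincipleFibreConductanceConditionalDefs
import Summits.AtomisticToContinuum.BoseEinsteinCondensation.Theorems.BECThomsonPrincipleFibreConductanceStubLocalChargeSq
import Summits.AtomisticToContinuum.BoseEinsteinCondensation.Theorems.BECThomsonPrincipleFibreConductanceStubLocalToGlobalHelpers
import Mathlib.MeasureTheory.Integral.MeanInequalities
import HarnessLib

/-!
# Route `BECThomsonPrinciple`, crux `FibreConductance` (stmt-AtomisticToContinuum-9480),
# line `conditional-law-poincare` — stub `stub_momentOfCDM`, part A: the per-cube moment bound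

`cubeMoment_le` (helper part A of the registered stub `stub_momentOfCDM`; the lead composes it with
part B — summation over cubes, fibre Fubini, `ConditionalDensityMoments` at `p = 6`): for every
zero-free state `Φ`, block count `ν`, mode `n`, cube `Q = cubeSet L ν Q` (side `ℓ = side L ν`,
`|Q| = ℓ³`) and fibre `X`: `U_Q · P_Q ≤ (5ℓ²/L³) · ∫_Q (1 + g⁶ + g⁻⁶) dy`, `g = L³ψ²`, where
`U_Q = localSqOf … = ∫_Q |q_loc|²` is the flat `L²` mass of the local part of the crux's charge
`q = cruxCharge n Φ` and `P_Q = holeFactor … = (∫_Q ψ⁻³)^{2/3}` is the hole factor.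

Proof. (1) On the cube `q_loc = q − ψ²c_Q/μ_Q` with `c_Q = cubeChargeOf`, `μ_Q = cubeMass` literally
the integrals of `LocalChargeSqBound` (`cm_localSqOf_cruxCharge_eq`), so `stub_localChargeSq` gives
`U_Q ≤ (2/L³)(a + ℓ³b/a)`, `a = ∫_Qψ²`, `b = ∫_Qψ⁴`. (2) With `G = ofReal g`: `L³a = ∫_Q G`,
`L⁶b = ∫_Q G²`, `P_Q = L³(∫_Q G^{-3/2})^{2/3}` (`cm_fibre_core`). (3) THE CORE (`cm_core`; normalised
form `cm_prob_core` on the probability measure `ℓ⁻³·vol|_Q`, cube averages `m_k = ⨍_Q g^k`):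
`(m₁ + m₂/m₁)·m_{-3/2}^{2/3} ≤ 2(1 + m₆ + m₋₆)` by Cauchy–Schwarz `1/m₁ ≤ m₋₁`, AM–GM
`xyz ≤ (x³+y³+z³)/3` on `m₁·1·B` and `m₂·m₋₁·B` (`B = m_{-3/2}^{2/3}`), Jensen `(∫f)^p ≤ ∫f^p`
(Hölder against `1`) and `g^{±3} ≤ 1 + g^{±6}`; un-normalised: `(A + ℓ³A₂/A)K^{2/3} ≤
2ℓ²∫_Q(1 + G⁶ + G⁻⁶)`, whence the constant `4 ≤ 5` (free gas `g ≡ 1`: `U_QP_Q ≤ 4ℓ⁵/L³`).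

Helper names carry the prefix `cm_`; `volume_cubeSet` is imported from `…StubLocalChargeSq`.
All [folklore] (Hölder, Young/AM–GM, elementary measure theory on the torus).
-/

noncomputable section

namespace Summit.AtomisticToContinuum.BoseEinsteinCondensation.Cruxes.FibreConductance.ConditionalLawPoincare

open MeasureTheory Set
open scoped ENNReal
open Literature.MathematicalPhysics.QuantumManyBody.BoseGas
open Summit.AtomisticToContinuum.BoseEinsteinCondensation.Cruxes.FibreConductance.ParsevalShellBootstrap
open Summit.AtomisticToContinuum.BoseEinsteinCondensation.Cruxes.FibreConductance.HealingSplitKineticDefect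

variable {m : ℕ} {L : ℝ}

/-! ### Generic tools in `ℝ≥0∞`: AM–GM for three cubes, powers, Jensen, Cauchy–Schwarz -/

section Tools

variable {α : Type*} [MeasurableSpace α]

/-- AM–GM for three cubes in `ℝ≥0∞`: `xyz ≤ (x³ + y³ + z³)/3`. [folklore] -/
theorem cm_mul_three_le (x y z : ℝ≥0∞) : x * y * z ≤ x ^ 3 / 3 + y ^ 3 / 3 + z ^ 3 / 3 := by
  have h3 : (3 : ℝ≥0∞) ≠ ⊤ := ENNReal.ofNat_ne_top
  rcases eq_or_ne x ⊤ with rfl | hx; · exact le_top.trans_eq (by simp [ENNReal.top_div_of_ne_top h3])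
  rcases eq_or_ne y ⊤ with rfl | hy; · exact le_top.trans_eq (by simp [ENNReal.top_div_of_ne_top h3])
  rcases eq_or_ne z ⊤ with rfl | hz; · exact le_top.trans_eq (by simp [ENNReal.top_div_of_ne_top h3])
  lift x to NNReal using hx
  lift y to NNReal using hy
  lift z to NNReal using hz
  have key : x * y * z ≤ (x ^ 3 + y ^ 3 + z ^ 3) / 3 := by
    rw [← NNReal.coe_le_coe]
    push_cast
    have hx := x.coe_nonneg; have hy := y.coe_nonneg; have hz := z.coe_nonneg
    have hs : (0 : ℝ) ≤ x + y + z := by positivity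
    nlinarith [mul_nonneg hs (sq_nonneg ((x : ℝ) - y)), mul_nonneg hs (sq_nonneg ((y : ℝ) - z)),
      mul_nonneg hs (sq_nonneg ((z : ℝ) - x))]
  calc (x : ℝ≥0∞) * y * z = ((x * y * z : NNReal) : ℝ≥0∞) := by norm_cast
    _ ≤ (((x ^ 3 + y ^ 3 + z ^ 3) / 3 : NNReal) : ℝ≥0∞) := by exact_mod_cast key
    _ = (x : ℝ≥0∞) ^ 3 / 3 + (y : ℝ≥0∞) ^ 3 / 3 + (z : ℝ≥0∞) ^ 3 / 3 := by
        rw [ENNReal.coe_div (by norm_num)]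
        push_cast
        rw [ENNReal.add_div, ENNReal.add_div]

/-- `x^j ≤ 1 + x^k` for `j ≤ k` in `ℝ≥0∞` (split at `x = 1`). [folklore] -/
theorem cm_pow_le_one_add_pow (x : ℝ≥0∞) {j k : ℕ} (hjk : j ≤ k) : x ^ j ≤ 1 + x ^ k := by
  rcases le_total x 1 with h | h
  · exact (pow_le_one₀ zero_le h).trans le_self_add
  · exact (pow_le_pow_right₀ h hjk).trans le_add_self

/-- Jensen for a probability measure in `ℝ≥0∞`: `(∫ f)^p ≤ ∫ f^p` for `p > 1` (Hölder against `1`).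
[folklore] -/
theorem cm_lintegral_rpow_le (μ : Measure α) [IsProbabilityMeasure μ] {f : α → ℝ≥0∞}
    (hf : AEMeasurable f μ) {p : ℝ} (hp : 1 < p) :
    (∫⁻ x, f x ∂μ) ^ p ≤ ∫⁻ x, f x ^ p ∂μ := by
  have hpq := Real.HolderConjugate.conjExponent hp
  have h := ENNReal.lintegral_mul_le_Lp_mul_Lq μ hpq hf (aemeasurable_const (b := (1 : ℝ≥0∞)))
  simp only [Pi.mul_apply, mul_one, ENNReal.one_rpow, lintegral_const, measure_univ] at h
  have h0 : 0 < p := by linarith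
  calc (∫⁻ x, f x ∂μ) ^ p ≤ ((∫⁻ x, f x ^ p ∂μ) ^ (1 / p)) ^ p := ENNReal.rpow_le_rpow h h0.le
    _ = ∫⁻ x, f x ^ p ∂μ := by rw [one_div, ENNReal.rpow_inv_rpow h0.ne']

/-- Jensen for a probability measure in `ℝ≥0∞`, natural powers `n ≥ 2`. [folklore] -/
theorem cm_lintegral_pow_le (μ : Measure α) [IsProbabilityMeasure μ] {f : α → ℝ≥0∞}
    (hf : AEMeasurable f μ) {n : ℕ} (hn : 1 < n) :
    (∫⁻ x, f x ∂μ) ^ n ≤ ∫⁻ x, f x ^ n ∂μ := by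
  have h := cm_lintegral_rpow_le μ hf (p := n) (by exact_mod_cast hn)
  simpa only [ENNReal.rpow_natCast] using h

/-- Cauchy–Schwarz `1 = (∫ √G·√(1/G))² ≤ (∫ G)(∫ G⁻¹)` for a probability measure (`0 < G < ∞`).
[folklore] -/
theorem cm_one_le_lintegral_mul_lintegral_inv (μ : Measure α) [IsProbabilityMeasure μ]
    {G : α → ℝ≥0∞} (hG : Measurable G) (h0 : ∀ x, G x ≠ 0) (htop : ∀ x, G x ≠ ⊤) :
    1 ≤ (∫⁻ x, G x ∂μ) * ∫⁻ x, (G x)⁻¹ ∂μ := by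
  have h := lintegral_sqrt_mul_sqrt_le μ hG.aemeasurable hG.inv.aemeasurable
  have e : ∀ x, G x ^ (1 / 2 : ℝ) * (G x)⁻¹ ^ (1 / 2 : ℝ) = 1 := fun x => by
    rw [← ENNReal.mul_rpow_of_nonneg _ _ (by norm_num), ENNReal.mul_inv_cancel (h0 x) (htop x),
      ENNReal.one_rpow]
  simp only [Pi.inv_apply, e, lintegral_const, measure_univ, mul_one] at h
  have h2 := sq_le_of_le_sqrt (x := 1) (c := 1) (u := ∫⁻ x, G x ∂μ) (v := ∫⁻ x, (G x)⁻¹ ∂μ)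
    (by rwa [ENNReal.one_rpow, one_mul])
  simpa only [one_pow, one_mul] using h2

/-- THE NORMALISED CORE (probability measure `μ`, `0 < G < ∞` measurable; `m_k = ∫ G^k dμ`):
`(m₁ + m₂/m₁)·m_{-3/2}^{2/3} ≤ 2·∫(1 + G⁶ + G⁻⁶) dμ`. Proof: `1/m₁ ≤ m₋₁` (Cauchy–Schwarz), AM–GM
`xyz ≤ (x³ + y³ + z³)/3` on `m₁·1·B` and `m₂·m₋₁·B` (`B = m_{-3/2}^{2/3}`, `B³ = m_{-3/2}²`), Jensen
`m₁³ ≤ m₃`, `m₂³ ≤ m₆`, `m₋₁³ ≤ m₋₃`, `m_{-3/2}² ≤ m₋₃`, and `G^{±3} ≤ 1 + G^{±6}` pointwise. [folklore] -/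
theorem cm_prob_core (μ : Measure α) [IsProbabilityMeasure μ] {G : α → ℝ≥0∞} (hG : Measurable G)
    (h0 : ∀ x, G x ≠ 0) (htop : ∀ x, G x ≠ ⊤) :
    ((∫⁻ x, G x ∂μ) + (∫⁻ x, G x ^ 2 ∂μ) / (∫⁻ x, G x ∂μ)) *
        (∫⁻ x, (G x)⁻¹ ^ (3 / 2 : ℝ) ∂μ) ^ (2 / 3 : ℝ) ≤
      2 * ∫⁻ x, (1 + G x ^ 6 + (G x)⁻¹ ^ 6) ∂μ := by
  have hGi : Measurable fun x => (G x)⁻¹ := hG.inv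
  set m₁ := ∫⁻ x, G x ∂μ
  set m₂ := ∫⁻ x, G x ^ 2 ∂μ
  set n₁ := ∫⁻ x, (G x)⁻¹ ∂μ
  set K := ∫⁻ x, (G x)⁻¹ ^ (3 / 2 : ℝ) ∂μ
  set F := ∫⁻ x, (1 + G x ^ 6 + (G x)⁻¹ ^ 6) ∂μ
  set B := K ^ (2 / 3 : ℝ) with hB
  -- Jensen
  have J1 : m₁ ^ 3 ≤ ∫⁻ x, G x ^ 3 ∂μ := cm_lintegral_pow_le μ hG.aemeasurable (by norm_num)
  have J2 : m₂ ^ 3 ≤ ∫⁻ x, G x ^ 6 ∂μ := by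
    refine (cm_lintegral_pow_le μ (hG.pow_const 2).aemeasurable (by norm_num)).trans_eq ?_
    exact lintegral_congr fun x => by rw [← pow_mul]
  have J3 : n₁ ^ 3 ≤ ∫⁻ x, (G x)⁻¹ ^ 3 ∂μ := cm_lintegral_pow_le μ hGi.aemeasurable (by norm_num)
  have J4 : B ^ 3 ≤ ∫⁻ x, (G x)⁻¹ ^ 3 ∂μ := by
    have hB3 : B ^ 3 = K ^ 2 := by
      rw [hB, ← ENNReal.rpow_natCast, ← ENNReal.rpow_mul]
      norm_num
    rw [hB3]
    refine (cm_lintegral_pow_le μ (hGi.pow_const _).aemeasurable (by norm_num)).trans_eq ?_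
    refine lintegral_congr fun x => ?_
    rw [← ENNReal.rpow_natCast, ← ENNReal.rpow_mul]
    norm_num
  -- Cauchy–Schwarz and `m₂/m₁ ≤ m₂ m₋₁`
  have CS : 1 ≤ m₁ * n₁ := cm_one_le_lintegral_mul_lintegral_inv μ hG h0 htop
  have hm₁0 : m₁ ≠ 0 := fun h => absurd CS (by rw [h, zero_mul]; exact not_le.mpr zero_lt_one)
  have hinv : m₁⁻¹ ≤ n₁ := by
    rcases eq_or_ne m₁ ⊤ with h | h
    · rw [h, ENNReal.inv_top]
      exact zero_le
    · calc m₁⁻¹ = m₁⁻¹ * 1 := (mul_one _).symm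
        _ ≤ m₁⁻¹ * (m₁ * n₁) := by gcongr
        _ = n₁ := by rw [← mul_assoc, ENNReal.inv_mul_cancel hm₁0 h, one_mul]
  have hdiv : m₂ / m₁ ≤ m₂ * n₁ := by
    rw [div_eq_mul_inv]
    gcongr
  -- pointwise bounds into `F`
  have P0 : 1 ≤ F := by
    calc (1 : ℝ≥0∞) = ∫⁻ _, 1 ∂μ := by rw [lintegral_const, measure_univ, mul_one]
      _ ≤ F := lintegral_mono fun x => le_add_right (le_add_right le_rfl)
  have P3 : ∫⁻ x, G x ^ 3 ∂μ ≤ F :=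
    lintegral_mono fun x => le_add_right (cm_pow_le_one_add_pow (G x) (by norm_num))
  have P6 : ∫⁻ x, G x ^ 6 ∂μ ≤ F := lintegral_mono fun x => le_add_right le_add_self
  have Pn3 : ∫⁻ x, (G x)⁻¹ ^ 3 ∂μ ≤ F :=
    lintegral_mono fun x => (cm_pow_le_one_add_pow (G x)⁻¹ (by norm_num : 3 ≤ 6)).trans
      (add_le_add (le_add_right le_rfl) le_rfl)
  -- assemble
  calc (m₁ + m₂ / m₁) * B = m₁ * 1 * B + m₂ / m₁ * B := by rw [add_mul, mul_one]
    _ ≤ m₁ * 1 * B + m₂ * n₁ * B := by gcongr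
    _ ≤ (m₁ ^ 3 / 3 + 1 ^ 3 / 3 + B ^ 3 / 3) + (m₂ ^ 3 / 3 + n₁ ^ 3 / 3 + B ^ 3 / 3) :=
        add_le_add (cm_mul_three_le _ _ _) (cm_mul_three_le _ _ _)
    _ ≤ (F / 3 + F / 3 + F / 3) + (F / 3 + F / 3 + F / 3) := by
        have h1 : m₁ ^ 3 ≤ F := J1.trans P3
        have h2 : (1 : ℝ≥0∞) ^ 3 ≤ F := by rwa [one_pow]
        have h3 : B ^ 3 ≤ F := J4.trans Pn3
        have h4 : m₂ ^ 3 ≤ F := J2.trans P6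
        have h5 : n₁ ^ 3 ≤ F := J3.trans Pn3
        gcongr
    _ = 2 * F := by rw [ENNReal.add_thirds, two_mul]

/-- THE CORE ON A CUBE OF VOLUME `l³` (finite measure `μ`, `μ(univ) = l³`, `0 < l < ∞`; un-normalised
form of `cm_prob_core` via `μ = l³ · (l⁻³μ)`):
`(A + l³A₂/A)·K^{2/3} ≤ 2l²·∫(1 + G⁶ + G⁻⁶) dμ`, `A = ∫G`, `A₂ = ∫G²`, `K = ∫G^{-3/2}`. [folklore] -/
theorem cm_core (μ : Measure α) {l : ℝ≥0∞} (hl0 : l ≠ 0) (hlt : l ≠ ⊤) (hμ : μ univ = l ^ 3)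
    {G : α → ℝ≥0∞} (hG : Measurable G) (h0 : ∀ x, G x ≠ 0) (htop : ∀ x, G x ≠ ⊤) :
    ((∫⁻ x, G x ∂μ) + l ^ 3 * (∫⁻ x, G x ^ 2 ∂μ) / (∫⁻ x, G x ∂μ)) *
        (∫⁻ x, (G x)⁻¹ ^ (3 / 2 : ℝ) ∂μ) ^ (2 / 3 : ℝ) ≤
      2 * l ^ 2 * ∫⁻ x, (1 + G x ^ 6 + (G x)⁻¹ ^ 6) ∂μ := by
  have hl3 : l ^ 3 ≠ 0 := pow_ne_zero _ hl0
  have hl3t : l ^ 3 ≠ ⊤ := ENNReal.pow_ne_top hlt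
  have hl2 : l ^ 2 ≠ 0 := pow_ne_zero _ hl0
  have hl2t : l ^ 2 ≠ ⊤ := ENNReal.pow_ne_top hlt
  haveI : IsFiniteMeasure μ := ⟨by rw [hμ]; exact hl3t.lt_top⟩
  haveI : NeZero μ := ⟨fun h => hl3 (by rw [← hμ]; exact Measure.measure_univ_eq_zero.2 h)⟩
  have h := cm_prob_core ((μ univ)⁻¹ • μ) hG h0 htop
  simp only [lintegral_smul_measure, smul_eq_mul, hμ] at h
  rw [ENNReal.mul_div_mul_left _ _ (ENNReal.inv_ne_zero.2 hl3t) (ENNReal.inv_ne_top.2 hl3),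
    ENNReal.mul_rpow_of_nonneg _ _ (by norm_num : (0 : ℝ) ≤ 2 / 3)] at h
  have hc23 : (l ^ 3)⁻¹ ^ (2 / 3 : ℝ) = (l ^ 2)⁻¹ := by
    rw [ENNReal.inv_pow, ENNReal.inv_pow, ← ENNReal.rpow_natCast _ 3, ← ENNReal.rpow_mul]
    norm_num
  rw [hc23] at h
  have hlc : l ^ 3 * (l ^ 3)⁻¹ = 1 := ENNReal.mul_inv_cancel hl3 hl3t
  set A := ∫⁻ x, G x ∂μ
  set A₂ := ∫⁻ x, G x ^ 2 ∂μ
  set K' := (∫⁻ x, (G x)⁻¹ ^ (3 / 2 : ℝ) ∂μ) ^ (2 / 3 : ℝ)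
  set F := ∫⁻ x, (1 + G x ^ 6 + (G x)⁻¹ ^ 6) ∂μ
  calc (A + l ^ 3 * A₂ / A) * K'
      = (l ^ 3 * ((l ^ 3)⁻¹ * A + A₂ / A)) * (l ^ 2 * ((l ^ 2)⁻¹ * K')) := by
        conv_rhs => rw [mul_add, ← mul_assoc (l ^ 3) (l ^ 3)⁻¹ A, hlc, one_mul, ← mul_div_assoc,
          ← mul_assoc (l ^ 2) (l ^ 2)⁻¹ K', ENNReal.mul_inv_cancel hl2 hl2t, one_mul]
    _ = l ^ 3 * l ^ 2 * (((l ^ 3)⁻¹ * A + A₂ / A) * ((l ^ 2)⁻¹ * K')) := by ring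
    _ ≤ l ^ 3 * l ^ 2 * (2 * ((l ^ 3)⁻¹ * F)) := by gcongr
    _ = 2 * l ^ 2 * (l ^ 3 * (l ^ 3)⁻¹) * F := by ring
    _ = 2 * l ^ 2 * F := by rw [hlc, mul_one]

end Tools

/-! ### The per-cube bound on an abstract fibre -/

/-- THE PER-CUBE BOUND ON AN ABSTRACT FIBRE: for a continuous positive amplitude `ψ` on a set `S` of
volume `ℓ³` and any `U ≤ (2/L³)(a + ℓ³b/a)` (`a = ∫_Sψ²`, `b = ∫_Sψ⁴`, the shape of `stub_localChargeSq`),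
`U·(∫_S(ψ²)^{-3/2})^{2/3} ≤ (5ℓ²/L³)·∫_S(1 + g⁶ + g⁻⁶)`, `g = L³ψ²`. With `G = ofReal g`: `L³a = ∫G`,
`L⁶b = ∫G²`, `(ψ²)^{-3/2} = (L³)^{3/2}G^{-3/2}`, so `U·P ≤ (2/L³)(A + ℓ³A₂/A)K^{2/3} ≤ (4ℓ²/L³)∫(…)`. [folklore] -/
theorem cm_fibre_core (hL : 0 < L) {S : Set Space} {ℓ : ℝ} (hℓ : 0 < ℓ)
    (hvol : volume S = ENNReal.ofReal ℓ ^ 3) {ψ : Space → ℝ} (hψc : Continuous ψ)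
    (hψ : ∀ y, 0 < ψ y) (i2 : IntegrableOn (fun z => ψ z ^ 2) S)
    (i4 : IntegrableOn (fun z => ψ z ^ 4) S) {U : ℝ≥0∞}
    (hU : U ≤ ENNReal.ofReal (2 / L ^ 3 * ((∫ z in S, ψ z ^ 2) +
      ℓ ^ 3 * (∫ z in S, ψ z ^ 4) / (∫ z in S, ψ z ^ 2)))) :
    U * (∫⁻ y in S, ENNReal.ofReal ((ψ y ^ 2) ^ (-(3 / 2 : ℝ)))) ^ (2 / 3 : ℝ) ≤
      ENNReal.ofReal (5 * ℓ ^ 2 / L ^ 3) *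
        ∫⁻ y in S, ENNReal.ofReal (1 + (L ^ 3 * ψ y ^ 2) ^ 6 + ((L ^ 3 * ψ y ^ 2)⁻¹) ^ 6) := by
  have hL3 : 0 < L ^ 3 := pow_pos hL 3
  have hg : ∀ y, 0 < L ^ 3 * ψ y ^ 2 := fun y => mul_pos hL3 (pow_pos (hψ y) 2)
  have hGm : Measurable fun y => ENNReal.ofReal (L ^ 3 * ψ y ^ 2) :=
    (continuous_const.mul (hψc.pow 2)).measurable.ennreal_ofReal
  have hGi : Measurable fun y => (ENNReal.ofReal (L ^ 3 * ψ y ^ 2))⁻¹ ^ (3 / 2 : ℝ) :=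
    hGm.inv.pow_const _
  have hG0 : ∀ y, ENNReal.ofReal (L ^ 3 * ψ y ^ 2) ≠ 0 := fun y => (ENNReal.ofReal_pos.2 (hg y)).ne'
  have hGt : ∀ y, ENNReal.ofReal (L ^ 3 * ψ y ^ 2) ≠ ⊤ := fun _ => ENNReal.ofReal_ne_top
  have hl0 : ENNReal.ofReal ℓ ≠ 0 := (ENNReal.ofReal_pos.2 hℓ).ne'
  have hvol' : volume.restrict S univ = ENNReal.ofReal ℓ ^ 3 := by
    rw [Measure.restrict_apply_univ, hvol]
  -- the cube mass is positive, `∫ ψ⁴ ≥ 0`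
  have ha : 0 < ∫ z in S, ψ z ^ 2 := by
    rw [integral_pos_iff_support_of_nonneg_ae (Filter.Eventually.of_forall fun z => sq_nonneg (ψ z))
      i2, show Function.support (fun z => ψ z ^ 2) = univ from
        eq_univ_of_forall fun z => (pow_pos (hψ z) 2).ne', hvol']
    exact ENNReal.pow_pos (ENNReal.ofReal_pos.2 hℓ) 3
  have ha' : (∫ z in S, ψ z ^ 2) ≠ 0 := ha.ne'
  have hb : 0 ≤ ∫ z in S, ψ z ^ 4 := integral_nonneg fun z => by positivity
  -- conversions: `L³a = ∫G`, `L⁶b = ∫G²`, the hole factor, the right-hand side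
  have hA : ENNReal.ofReal (L ^ 3 * ∫ z in S, ψ z ^ 2) =
      ∫⁻ y in S, ENNReal.ofReal (L ^ 3 * ψ y ^ 2) := by
    rw [← integral_const_mul, ofReal_integral_eq_lintegral_ofReal (i2.const_mul _)
      (Filter.Eventually.of_forall fun z => (hg z).le)]
  have hA2 : ENNReal.ofReal ((L ^ 3) ^ 2 * ∫ z in S, ψ z ^ 4) =
      ∫⁻ y in S, ENNReal.ofReal (L ^ 3 * ψ y ^ 2) ^ 2 := by
    rw [← integral_const_mul, ofReal_integral_eq_lintegral_ofReal (i4.const_mul _)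
      (Filter.Eventually.of_forall fun z => by positivity)]
    refine lintegral_congr fun y => ?_
    rw [← ENNReal.ofReal_pow (hg y).le]
    congr 1
    ring
  have hK : (∫⁻ y in S, ENNReal.ofReal ((ψ y ^ 2) ^ (-(3 / 2 : ℝ)))) ^ (2 / 3 : ℝ) =
      ENNReal.ofReal (L ^ 3) *
        (∫⁻ y in S, (ENNReal.ofReal (L ^ 3 * ψ y ^ 2))⁻¹ ^ (3 / 2 : ℝ)) ^ (2 / 3 : ℝ) := by
    have hpt : ∀ y, ENNReal.ofReal ((ψ y ^ 2) ^ (-(3 / 2 : ℝ))) =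
        ENNReal.ofReal ((L ^ 3) ^ (3 / 2 : ℝ)) *
          (ENNReal.ofReal (L ^ 3 * ψ y ^ 2))⁻¹ ^ (3 / 2 : ℝ) := by
      intro y
      have hψ2 : 0 < ψ y ^ 2 := pow_pos (hψ y) 2
      rw [← ENNReal.ofReal_inv_of_pos (hg y), ENNReal.ofReal_rpow_of_pos (inv_pos.2 (hg y)),
        ← ENNReal.ofReal_mul (p := (L ^ 3) ^ (3 / 2 : ℝ)) (by positivity)]
      congr 1
      rw [mul_inv, Real.mul_rpow (inv_nonneg.2 hL3.le) (inv_nonneg.2 hψ2.le), ← mul_assoc,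
        ← Real.mul_rpow hL3.le (inv_nonneg.2 hL3.le), mul_inv_cancel₀ hL3.ne', Real.one_rpow,
        one_mul, Real.inv_rpow hψ2.le, Real.rpow_neg hψ2.le]
    simp_rw [hpt]
    rw [lintegral_const_mul _ hGi, ENNReal.mul_rpow_of_nonneg _ _ (by norm_num),
      ENNReal.ofReal_rpow_of_pos (Real.rpow_pos_of_pos hL3 _), ← Real.rpow_mul hL3.le]
    norm_num
  have hF : ∫⁻ y in S, ENNReal.ofReal (1 + (L ^ 3 * ψ y ^ 2) ^ 6 + ((L ^ 3 * ψ y ^ 2)⁻¹) ^ 6) =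
      ∫⁻ y in S, (1 + ENNReal.ofReal (L ^ 3 * ψ y ^ 2) ^ 6 +
        (ENNReal.ofReal (L ^ 3 * ψ y ^ 2))⁻¹ ^ 6) := by
    refine lintegral_congr fun y => ?_
    rw [ENNReal.ofReal_add (by positivity) (by positivity),
      ENNReal.ofReal_add zero_le_one (by positivity), ENNReal.ofReal_one,
      ENNReal.ofReal_pow (hg y).le, ENNReal.ofReal_pow (inv_nonneg.2 (hg y).le),
      ENNReal.ofReal_inv_of_pos (hg y)]
  -- the core
  have hcore := cm_core (volume.restrict S) hl0 ENNReal.ofReal_ne_top hvol' hGm hG0 hGt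
  -- bookkeeping of the constants
  set a := ∫ z in S, ψ z ^ 2
  set b := ∫ z in S, ψ z ^ 4
  set A := ∫⁻ y in S, ENNReal.ofReal (L ^ 3 * ψ y ^ 2)
  set A₂ := ∫⁻ y in S, ENNReal.ofReal (L ^ 3 * ψ y ^ 2) ^ 2
  set K' := (∫⁻ y in S, (ENNReal.ofReal (L ^ 3 * ψ y ^ 2))⁻¹ ^ (3 / 2 : ℝ)) ^ (2 / 3 : ℝ)
  set F := ∫⁻ y in S, (1 + ENNReal.ofReal (L ^ 3 * ψ y ^ 2) ^ 6 +
    (ENNReal.ofReal (L ^ 3 * ψ y ^ 2))⁻¹ ^ 6)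
  have e1 : ENNReal.ofReal (2 / L ^ 3) * (A + ENNReal.ofReal ℓ ^ 3 * A₂ / A) =
      ENNReal.ofReal (2 / L ^ 3 * (a + ℓ ^ 3 * b / a) * L ^ 3) := by
    rw [← hA, ← hA2, ← ENNReal.ofReal_pow hℓ.le, ← ENNReal.ofReal_mul (p := ℓ ^ 3) (by positivity),
      ← ENNReal.ofReal_div_of_pos (y := L ^ 3 * a) (by positivity),
      ← ENNReal.ofReal_add (p := L ^ 3 * a) (q := ℓ ^ 3 * ((L ^ 3) ^ 2 * b) / (L ^ 3 * a))
        (by positivity) (by positivity),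
      ← ENNReal.ofReal_mul (p := 2 / L ^ 3) (by positivity)]
    congr 1
    field_simp
  have e2 : ENNReal.ofReal (2 / L ^ 3) * (2 * ENNReal.ofReal ℓ ^ 2) =
      ENNReal.ofReal (4 * ℓ ^ 2 / L ^ 3) := by
    rw [← ENNReal.ofReal_pow hℓ.le, show (2 : ℝ≥0∞) = ENNReal.ofReal 2 by norm_num,
      ← ENNReal.ofReal_mul (p := 2) zero_le_two, ← ENNReal.ofReal_mul (p := 2 / L ^ 3) (by positivity)]
    congr 1
    ring
  calc U * (∫⁻ y in S, ENNReal.ofReal ((ψ y ^ 2) ^ (-(3 / 2 : ℝ)))) ^ (2 / 3 : ℝ)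
      = U * (ENNReal.ofReal (L ^ 3) * K') := by rw [hK]
    _ ≤ ENNReal.ofReal (2 / L ^ 3 * (a + ℓ ^ 3 * b / a)) * (ENNReal.ofReal (L ^ 3) * K') :=
        mul_le_mul' hU le_rfl
    _ = ENNReal.ofReal (2 / L ^ 3 * (a + ℓ ^ 3 * b / a) * L ^ 3) * K' := by
        rw [← mul_assoc, ← ENNReal.ofReal_mul (p := 2 / L ^ 3 * (a + ℓ ^ 3 * b / a)) (by positivity)]
    _ = ENNReal.ofReal (2 / L ^ 3) * ((A + ENNReal.ofReal ℓ ^ 3 * A₂ / A) * K') := by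
        rw [← e1, mul_assoc]
    _ ≤ ENNReal.ofReal (2 / L ^ 3) * (2 * ENNReal.ofReal ℓ ^ 2 * F) := mul_le_mul' le_rfl hcore
    _ = ENNReal.ofReal (4 * ℓ ^ 2 / L ^ 3) * F := by rw [← e2]; ring
    _ ≤ ENNReal.ofReal (5 * ℓ ^ 2 / L ^ 3) * F := by gcongr; norm_num
    _ = _ := by rw [hF]

/-! ### The registered signature -/

/-- `U_Q = ∫⁻_Q ‖q_loc‖ₑ²` is `ofReal` of the (finite) flat `L²` mass of the continuous branch
`q − ψ²c_Q/μ_Q` of the local charge on the cube. [folklore] -/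
theorem cm_localSqOf_cruxCharge_eq (hL : 0 < L) {ν : ℕ} (n : Fin 3 → ℤ)
    (Φ : PeriodicTrialState (m + 1) L) (hΦ : ∀ X, Φ.ψ X ≠ 0) (Q : Fin 3 → Fin (ν + 1))
    (X : Config (m + 1)) :
    localSqOf L ν Φ (cruxCharge n Φ) Q X = ENNReal.ofReal (∫ y in cubeSet L ν Q,
      ‖cruxCharge n Φ (Function.update X 0 y) - ((fibrePsi Φ (Function.update X 0 y) ^ 2 : ℝ) : ℂ) *
        (cubeChargeOf L ν (cruxCharge n Φ) Q X / (cubeMass L ν Φ Q X : ℂ))‖ ^ 2) := by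
  have hu : Continuous fun y : Space => Function.update X 0 y := continuous_const.update 0 continuous_id
  have hc : Continuous fun y : Space => cruxCharge n Φ (Function.update X 0 y) -
      ((fibrePsi Φ (Function.update X 0 y) ^ 2 : ℝ) : ℂ) *
        (cubeChargeOf L ν (cruxCharge n Φ) Q X / (cubeMass L ν Φ Q X : ℂ)) :=
    ((continuous_cruxCharge hL n Φ hΦ).comp hu).sub
      ((Complex.continuous_ofReal.comp (((continuous_fibrePsi hL Φ hΦ).comp hu).pow 2)).mul
        continuous_const)
  have hi : IntegrableOn (fun y : Space => ‖cruxCharge n Φ (Function.update X 0 y) -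
      ((fibrePsi Φ (Function.update X 0 y) ^ 2 : ℝ) : ℂ) *
        (cubeChargeOf L ν (cruxCharge n Φ) Q X / (cubeMass L ν Φ Q X : ℂ))‖ ^ 2) (cubeSet L ν Q) :=
    integrableOn_cubeSet hL Q (hc.norm.pow 2)
  rw [ofReal_integral_eq_lintegral_ofReal hi (Filter.Eventually.of_forall fun y => sq_nonneg _)]
  unfold localSqOf
  refine setLIntegral_congr_fun (measurableSet_cubeSet L ν Q) fun y hy => ?_
  rw [localOf_update_of_mem hL Φ _ X hy, ← ofReal_norm, ENNReal.ofReal_pow (norm_nonneg _)]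

/-- **`stub_momentOfCDM`, part A (helper name `cubeMoment_le`) — THE PER-CUBE MOMENT BOUND.** For
every zero-free state, block count `ν`, mode `n`, cube `Q` and fibre `X`:
`U_Q·P_Q ≤ (5ℓ²/L³)·∫_Q (1 + g⁶ + g⁻⁶) dy`, `g = L³ψ²`, `ℓ = side L ν` (`U_Q = localSqOf = ∫_Q|q_loc|²`,
`P_Q = holeFactor = (∫_Qψ⁻³)^{2/3}`). Proof: `U_Q` is `ofReal` of the left side of `LocalChargeSqBound`
(`cm_localSqOf_cruxCharge_eq`), whence `U_Q ≤ (2/L³)(μ_Q + ℓ³∫_Qψ⁴/μ_Q)`; then `cm_fibre_core`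
(Cauchy–Schwarz `1/m₁ ≤ m₋₁`, AM–GM, Jensen, `g^{±3} ≤ 1 + g^{±6}`; constant `4 ≤ 5`). [folklore] -/
theorem cubeMoment_le (hlcs : LocalChargeSqBound) :
    ∀ (m : ℕ) (L : ℝ), 0 < L → ∀ (ν : ℕ) (n : Fin 3 → ℤ) (Φ : PeriodicTrialState (m + 1) L),
      (∀ X, Φ.ψ X ≠ 0) → ∀ (Q : Fin 3 → Fin (ν + 1)) (X : Config (m + 1)),
        localSqOf L ν Φ (cruxCharge n Φ) Q X * holeFactor L ν Φ Q X ≤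
          ENNReal.ofReal (5 * side L ν ^ 2 / L ^ 3) *
            ∫⁻ y in cubeSet L ν Q, ENNReal.ofReal (1 + (L ^ 3 * fibrePsi Φ (Function.update X 0 y) ^ 2) ^ 6 +
              ((L ^ 3 * fibrePsi Φ (Function.update X 0 y) ^ 2)⁻¹) ^ 6) := by
  intro m L hL ν n Φ hΦ Q X
  have hψc : Continuous fun y : Space => fibrePsi Φ (Function.update X 0 y) :=
    (continuous_fibrePsi hL Φ hΦ).comp (continuous_const.update 0 continuous_id)
  have hU : localSqOf L ν Φ (cruxCharge n Φ) Q X ≤ ENNReal.ofReal (2 / L ^ 3 *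
      ((∫ z in cubeSet L ν Q, fibrePsi Φ (Function.update X 0 z) ^ 2) +
        side L ν ^ 3 * (∫ z in cubeSet L ν Q, fibrePsi Φ (Function.update X 0 z) ^ 4) /
          (∫ z in cubeSet L ν Q, fibrePsi Φ (Function.update X 0 z) ^ 2))) := by
    rw [cm_localSqOf_cruxCharge_eq hL n Φ hΦ Q X]
    exact ENNReal.ofReal_le_ofReal (hlcs m L hL ν n Φ hΦ Q X)
  exact cm_fibre_core (ψ := fun y => fibrePsi Φ (Function.update X 0 y)) hL (side_pos hL ν)
    (volume_cubeSet L ν Q) hψc (fun y => fibrePsi_pos hL Φ hΦ _)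
    (integrableOn_cubeSet hL Q (hψc.pow 2)) (integrableOn_cubeSet hL Q (hψc.pow 4)) hU

end Summit.AtomisticToContinuum.BoseEinsteinCondensation.Cruxes.FibreConductance.ConditionalLawPoincare

end
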